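import Literature.NumberTheory.EllipticCurves.FormalLogExpBaseChangeProofs
import Literature.NumberTheory.EllipticCurves.IsogenyOfAlgebraicDependenceProofs
import Literature.NumberTheory.EllipticCurves.ComplexTorusAddProofs
import Mathlib.Analysis.Complex.TaylorSeries
import Mathlib.Analysis.Normed.Module.Connected
import Mathlib.Topology.Algebra.Module.Cardinality
import Mathlib.Analysis.Analytic.Uniqueness
import HarnessLib

/-!
# From a formal algebraic relation `P(x, y(x)) = 0` for the leaf `y = exp_{E'}(log_E x)` to a
# `ℚ`-isogeny `E ~ E'` (Bost 2001, Cor. 2.5: "if `h` is algebraic …"; proofs only)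

Topic `Literature/NumberTheory/EllipticCurves`; a proofs-only file (theorems only). This is the
analytic-continuation step between the OUTPUT of André's algebraicity criterion for the formal
leaf `y = exp_{E'}(log_E x) ∈ ℚ⟦x⟧` of Bost's line `h ⊂ Lie E ⊕ Lie E'` — a non-trivial relation
`Σ_{a ≤ d, b ≤ D} c_{ab} xᵃ y(x)ᵇ = 0` in `ℂ⟦x⟧` — and the last step of Bost's proof already in the
tree (`isIsogenous_of_evalEval_comp_eq_zero`, `IsogenyOfAlgebraicDependenceProofs`): for elliptic
curves `E, E'` over `ℚ` with Néron period pairs `L₁, L₂`,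

* the analytic function `h(z) = Σ c_{ab} t₁(z)ᵃ t₂(z)ᵇ` (`tᵢ = -xᵢ/yᵢ` the local parameters along the
  uniformisations, `FormalExpTaylorUniformizationProofs`) has Taylor series
  `Σ c_{ab} T̂₁ᵃ T̂₂ᵇ = (Σ c_{ab} xᵃyᵇ)(T̂₁) = 0` at `0` because `T̂₂ = y(T̂₁)`
  (`map_leaf_subst_taylor_localParam`), so `h = 0` near `0` (`eventuallyEq_zero_of_taylor_eq_zero`,
  Taylor's theorem `Complex.taylorSeries_eq_on_ball'`);
* `h` is analytic off the countable set `D = Λ₁ ∪ Λ₂ ∪ {y₁ = 0} ∪ {y₂ = 0}` (the zeros of `yᵢ` off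
  `Λᵢ` lie over the three roots of `x³ + a₂x² + a₄x + a₆`, hence in countably many fibres of `℘`,
  `countable_setOf_y_eq_zero`), and the open set of analyticity is preconnected (it contains the
  connected dense complement of `D`, `Set.Countable.isPathConnected_compl_of_one_lt_rank`), so by
  the identity theorem `h = 0` off `D` (`evalSum_localParam_eq_zero_of_compl`);
* with `gᵢ = (P ↦ -x(P)/y(P), O ↦ 0)` (finite fibres: `finite_setOf_eq_some_negX_div_Y_eq`) and the
  uniformisations `uᵢ` of `PeriodPair.exists_addMonoidHom_of_g₂_g₃'` one has `gᵢ ∘ uᵢ = tᵢ`, and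
  `isIsogenous_of_evalEval_comp_eq_zero` gives **`IsIsogenous E E'`**
  (`isIsogenous_of_sum_C_mul_X_pow_mul_leaf_pow_eq_zero`).

## References

* J.-B. Bost, Publ. Math. IHÉS 93 (2001), §2.1.1 (algebraic leaves: conditions 1–3), Cor. 2.5
  (proof, p. 173). [Bost2001AlgebraicLeaves]
* A. Chambert-Loir, Sém. Bourbaki 886 (2002), §6 (the shape of the criterion's output).
  [ChambertLoir2002Bourbaki]
-/

noncomputable section

open PowerSeries Filter Set Metric Literature.NumberTheory.Transcendental.AndreCriterion
open scoped Topology Nat Classical PeriodPair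

/-- The Taylor series of `f : ℂ → ℂ` at `0` (local notation, as in
`AndreCriterionAnalyticProofs`). -/
local notation3 "𝓣[" f "]" =>
  (PowerSeries.mk fun n => ((Nat.factorial n : ℂ)⁻¹ * iteratedDeriv n f 0) : PowerSeries ℂ)

namespace Literature.NumberTheory.EllipticCurves

/-! ### An analytic germ with vanishing Taylor series vanishes -/

/-- If `f` is analytic at `0` and all its derivatives vanish there, then `f = 0` near `0`
(Taylor's theorem on a disc). [folklore] -/
theorem eventuallyEq_zero_of_taylor_eq_zero {f : ℂ → ℂ} (hf : AnalyticAt ℂ f 0) (h : 𝓣[f] = 0) :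
    f =ᶠ[𝓝 0] 0 := by
  obtain ⟨r, hr, hfr⟩ := hf.exists_ball_analyticOnNhd
  have hder : ∀ n, iteratedDeriv n f 0 = 0 := fun n => by
    have := congrArg (coeff n) h
    rw [coeff_mk, map_zero, mul_eq_zero] at this
    exact this.resolve_left (inv_ne_zero (by exact_mod_cast Nat.factorial_ne_zero n))
  filter_upwards [ball_mem_nhds (0 : ℂ) hr] with z hz
  have ht := Complex.taylorSeries_eq_on_ball' hz hfr.differentiableOn
  simp only [hder, mul_zero, zero_mul, tsum_zero, sub_zero] at ht
  exact ht.symm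

/-! ### The zeros of `y = (℘' - a₁x - a₃)/2` off the lattice are countable -/

/-- **`{z ∉ Λ | y(z) = 0}` is countable** for `y = (℘' - a₁(℘ - b₂/12) - a₃)/2` on a Néron pair:
if `y = 0` then `x = ℘ - b₂/12` is a root of the cubic `x³ + a₂x² + a₄x + a₆`, and each fibre of
`℘` is countable. [folklore] -/
theorem countable_setOf_y_eq_zero (L : PeriodPair) (W : WeierstrassCurve ℂ) (h₂ : L.g₂ = W.c₄ / 12)
    (h₃ : L.g₃ = W.c₆ / 216) :
    {z : ℂ | z ∉ L.lattice ∧ (℘'[L] z - W.a₁ * (℘[L] z - W.b₂ / 12) - W.a₃) / 2 = 0}.Countable := by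
  set c : Polynomial ℂ := Polynomial.X ^ 3 + Polynomial.C W.a₂ * Polynomial.X ^ 2 +
    Polynomial.C W.a₄ * Polynomial.X + Polynomial.C W.a₆ with hc
  have hc0 : c ≠ 0 := by
    have h3 : c.coeff 3 = 1 := by
      simp only [hc, Polynomial.coeff_add, Polynomial.coeff_X_pow, Polynomial.coeff_C_mul,
        Polynomial.coeff_X, Polynomial.coeff_C]
      norm_num
    intro h
    rw [h, Polynomial.coeff_zero] at h3
    exact zero_ne_one h3
  have hfin : {r : ℂ | c.IsRoot r}.Finite := Polynomial.finite_setOf_isRoot hc0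
  refine ((hfin.countable.biUnion fun r _ =>
    L.countable_preimage_weierstrassP_singleton (r + W.b₂ / 12))).mono ?_
  rintro z ⟨hz, hy⟩
  have heq := WeierstrassCurve.equation_weierstrassP_sub L W h₂ h₃ hz
  rw [hy] at heq
  refine Set.mem_biUnion (x := ℘[L] z - W.b₂ / 12) ?_ ?_
  · change c.IsRoot (℘[L] z - W.b₂ / 12)
    simp only [hc, Polynomial.IsRoot.def, Polynomial.eval_add, Polynomial.eval_pow,
      Polynomial.eval_X, Polynomial.eval_mul, Polynomial.eval_C]
    linear_combination -heq
  · simp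

/-! ### The local parameter off the lattice -/

/-- `t = -x/y` is analytic at every `z ∉ Λ` with `y(z) ≠ 0`. [folklore] -/
theorem analyticAt_localParam_of_notMem (L : PeriodPair) (W : WeierstrassCurve ℂ) {z₀ : ℂ}
    (hz₀ : z₀ ∉ L.lattice) (hy : (℘'[L] z₀ - W.a₁ * (℘[L] z₀ - W.b₂ / 12) - W.a₃) / 2 ≠ 0) :
    AnalyticAt ℂ (fun z => if z ∈ L.lattice then (0 : ℂ) else
        -(℘[L] z - W.b₂ / 12) / ((℘'[L] z - W.a₁ * (℘[L] z - W.b₂ / 12) - W.a₃) / 2)) z₀ := by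
  have hopen : (L.lattice : Set ℂ)ᶜ ∈ 𝓝 z₀ := L.isClosed_lattice.isOpen_compl.mem_nhds hz₀
  have hwp : AnalyticAt ℂ ℘[L] z₀ := L.analyticOnNhd_weierstrassP z₀ hz₀
  have hwp' : AnalyticAt ℂ ℘'[L] z₀ := L.analyticOnNhd_derivWeierstrassP z₀ hz₀
  have h : AnalyticAt ℂ (fun z => -(℘[L] z - W.b₂ / 12) /
      ((℘'[L] z - W.a₁ * (℘[L] z - W.b₂ / 12) - W.a₃) / 2)) z₀ := by
    refine AnalyticAt.div (by fun_prop) (by fun_prop) hy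
  refine h.congr ?_
  filter_upwards [hopen] with z hz
  have hz' : z ∉ L.lattice := hz
  rw [if_neg hz']

end Literature.NumberTheory.EllipticCurves

namespace WeierstrassCurve

open Literature.NumberTheory.EllipticCurves PeriodPair

/-! ### `Σ c_{ab} t₁ᵃ t₂ᵇ = 0` off a countable set -/

/-- **From `Σ c_{ab} xᵃ y(x)ᵇ = 0` (formal) to `Σ c_{ab} t₁(z)ᵃ t₂(z)ᵇ = 0` off a countable set.**
Let `E, E'` be elliptic curves over `ℚ` (models `W₁, W₂`) with Néron period pairs `L₁, L₂` for
`E ⊗ ℂ, E' ⊗ ℂ`, `y = exp_{E'}(log_E x) ∈ ℚ⟦x⟧` the formal leaf and `tᵢ = -xᵢ/yᵢ` the local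
parameters along the uniformisations. If `Σ c_{ab} xᵃ yᵇ = 0` in `ℂ⟦x⟧` then
`Σ c_{ab} t₁(z)ᵃ t₂(z)ᵇ = 0` for every `z` off a countable set: the Taylor series of the left-hand
side at `0` is `(Σ c_{ab} xᵃ yᵇ)(T̂₁) = 0` (`T̂₂ = y(T̂₁)`), so it vanishes near `0`, and by
analytic continuation on the (preconnected) domain of analyticity, which contains the connected
complement of `Λ₁ ∪ Λ₂ ∪ {y₁ = 0} ∪ {y₂ = 0}`, it vanishes off that countable set.
[cite: Bost2001AlgebraicLeaves, Cor. 2.5 (proof) and §2.1.1] -/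
theorem evalSum_localParam_eq_zero_of_compl (W₁ W₂ : WeierstrassCurve ℚ) {L₁ L₂ : PeriodPair}
    (h₁₂ : L₁.g₂ = (W₁.baseChange ℂ).c₄ / 12) (h₁₃ : L₁.g₃ = (W₁.baseChange ℂ).c₆ / 216)
    (h₂₂ : L₂.g₂ = (W₂.baseChange ℂ).c₄ / 12) (h₂₃ : L₂.g₃ = (W₂.baseChange ℂ).c₆ / 216)
    {ι : Type*} (s : Finset ι) (c : ι → ℂ) (ea eb : ι → ℕ)
    (hS : ∑ i ∈ s, PowerSeries.C (c i) * (X ^ ea i *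
      (PowerSeries.map (algebraMap ℚ ℂ) (W₂.formalExp.subst W₁.formalLog)) ^ eb i) = 0) :
    ∃ D : Set ℂ, D.Countable ∧ ∀ z ∉ D,
      ∑ i ∈ s, c i * ((if z ∈ L₁.lattice then (0 : ℂ) else
        -(℘[L₁] z - (W₁.baseChange ℂ).b₂ / 12) / ((℘'[L₁] z - (W₁.baseChange ℂ).a₁ *
          (℘[L₁] z - (W₁.baseChange ℂ).b₂ / 12) - (W₁.baseChange ℂ).a₃) / 2)) ^ ea i *
        (if z ∈ L₂.lattice then (0 : ℂ) else
        -(℘[L₂] z - (W₂.baseChange ℂ).b₂ / 12) / ((℘'[L₂] z - (W₂.baseChange ℂ).a₁ *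
          (℘[L₂] z - (W₂.baseChange ℂ).b₂ / 12) - (W₂.baseChange ℂ).a₃) / 2)) ^ eb i) = 0 := by
  set V₁ := W₁.baseChange ℂ with hV₁
  set V₂ := W₂.baseChange ℂ with hV₂
  set t₁ : ℂ → ℂ := fun z => if z ∈ L₁.lattice then (0 : ℂ) else
    -(℘[L₁] z - V₁.b₂ / 12) / ((℘'[L₁] z - V₁.a₁ * (℘[L₁] z - V₁.b₂ / 12) - V₁.a₃) / 2) with ht₁
  set t₂ : ℂ → ℂ := fun z => if z ∈ L₂.lattice then (0 : ℂ) else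
    -(℘[L₂] z - V₂.b₂ / 12) / ((℘'[L₂] z - V₂.a₁ * (℘[L₂] z - V₂.b₂ / 12) - V₂.a₃) / 2) with ht₂
  set y : ℂ⟦X⟧ := PowerSeries.map (algebraMap ℚ ℂ) (W₂.formalExp.subst W₁.formalLog) with hy
  set h : ℂ → ℂ := fun z => ∑ i ∈ s, c i * (t₁ z ^ ea i * t₂ z ^ eb i) with hh
  -- analyticity of `t₁, t₂` at `0` and the key formal identity
  have ht₁a : AnalyticAt ℂ t₁ 0 := (analyticAt_localParam L₁ V₁).1
  have ht₂a : AnalyticAt ℂ t₂ 0 := (analyticAt_localParam L₂ V₂).1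
  have hkey : PowerSeries.subst 𝓣[t₁] y = 𝓣[t₂] :=
    map_leaf_subst_taylor_localParam W₁ W₂ L₁ L₂ h₁₂ h₁₃ h₂₂ h₂₃
  have ht₁0 : constantCoeff 𝓣[t₁] = 0 := by
    rw [constantCoeff_taylor, ht₁]
    exact if_pos (zero_mem _)
  -- the Taylor series of `h` vanishes
  have hha : AnalyticAt ℂ h 0 := by
    rw [hh]
    refine Finset.analyticAt_fun_sum _ fun i _ => ?_
    exact analyticAt_const.mul ((ht₁a.pow _).mul (ht₂a.pow _))
  have hTh : 𝓣[h] = 0 := by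
    have hfun : h = ∑ i ∈ s, fun z => c i * (t₁ ^ ea i * t₂ ^ eb i) z := by
      funext z
      simp only [hh, Finset.sum_apply, Pi.mul_apply, Pi.pow_apply]
    rw [hfun, taylor_sum _ fun i _ => ?_]
    · have hterm : ∀ i ∈ s, 𝓣[fun z => c i * (t₁ ^ ea i * t₂ ^ eb i) z] =
          PowerSeries.C (c i) * (𝓣[t₁] ^ ea i * 𝓣[t₂] ^ eb i) := fun i _ => by
        rw [taylor_const_mul, taylor_mul (ht₁a.pow _) (ht₂a.pow _), taylor_pow ht₁a, taylor_pow ht₂a]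
      rw [Finset.sum_congr rfl hterm, ← hkey,
        ← subst_sum_C_mul_X_pow_mul_pow s c ea eb y ht₁0, hS]
      have hs : HasSubst 𝓣[t₁] := HasSubst.of_constantCoeff_zero' ht₁0
      rw [← coe_substAlgHom hs, map_zero]
    · exact analyticAt_const.mul ((ht₁a.pow _).mul (ht₂a.pow _))
  have hh0 : h =ᶠ[𝓝 0] 0 := eventuallyEq_zero_of_taylor_eq_zero hha hTh
  -- the countable exceptional set
  set D : Set ℂ := (L₁.lattice : Set ℂ) ∪ (L₂.lattice : Set ℂ) ∪
    {z : ℂ | z ∉ L₁.lattice ∧ (℘'[L₁] z - V₁.a₁ * (℘[L₁] z - V₁.b₂ / 12) - V₁.a₃) / 2 = 0} ∪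
    {z : ℂ | z ∉ L₂.lattice ∧ (℘'[L₂] z - V₂.a₁ * (℘[L₂] z - V₂.b₂ / 12) - V₂.a₃) / 2 = 0} with hD
  have hDc : D.Countable :=
    ((L₁.countable_lattice.union L₂.countable_lattice).union
      (countable_setOf_y_eq_zero L₁ V₁ h₁₂ h₁₃)).union (countable_setOf_y_eq_zero L₂ V₂ h₂₂ h₂₃)
  -- `h` is analytic off `D`
  have hAn : ∀ z, z ∉ D → AnalyticAt ℂ h z := by
    intro z hz
    simp only [hD, Set.mem_union, Set.mem_setOf_eq, not_or, SetLike.mem_coe] at hz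
    obtain ⟨⟨⟨hz₁, hz₂⟩, hy₁⟩, hy₂⟩ := hz
    have hy₁' : (℘'[L₁] z - V₁.a₁ * (℘[L₁] z - V₁.b₂ / 12) - V₁.a₃) / 2 ≠ 0 := fun h' => hy₁ ⟨hz₁, h'⟩
    have hy₂' : (℘'[L₂] z - V₂.a₁ * (℘[L₂] z - V₂.b₂ / 12) - V₂.a₃) / 2 ≠ 0 := fun h' => hy₂ ⟨hz₂, h'⟩
    have h1 : AnalyticAt ℂ t₁ z := analyticAt_localParam_of_notMem L₁ V₁ hz₁ hy₁'
    have h2 : AnalyticAt ℂ t₂ z := analyticAt_localParam_of_notMem L₂ V₂ hz₂ hy₂'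
    rw [hh]
    exact Finset.analyticAt_fun_sum _ fun i _ => analyticAt_const.mul ((h1.pow _).mul (h2.pow _))
  -- the identity theorem on the domain of analyticity
  set U : Set ℂ := {z | AnalyticAt ℂ h z} with hU
  have hUopen : IsOpen U := isOpen_analyticAt ℂ h
  have hDU : Dᶜ ⊆ U := fun z hz => hAn z hz
  have hDconn : IsPreconnected Dᶜ :=
    (hDc.isPathConnected_compl_of_one_lt_rank (by simp [Complex.rank_real_complex])).isConnected.isPreconnected
  have hDdense : Dense Dᶜ := hDc.dense_compl ℝ
  have hUconn : IsPreconnected U := hDconn.subset_closure hDU (by rw [hDdense.closure_eq]; exact subset_univ _)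
  have hEq : EqOn h 0 U :=
    AnalyticOnNhd.eqOn_zero_of_preconnected_of_eventuallyEq_zero (fun z hz => hz) hUconn hha hh0
  refine ⟨D, hDc, fun z hz => ?_⟩
  have := hEq (hDU hz)
  simpa only [hh, ht₁, ht₂, Pi.zero_apply] using this

/-! ### The isogeny -/

/-- **A non-trivial algebraic relation `Σ c_{ab} xᵃ y(x)ᵇ = 0` for the formal leaf
`y = exp_{E'}(log_E x)` forces `E ~ E'` over `ℚ`.** For elliptic curves `E, E'` over `ℚ`
(Weierstrass models `W₁, W₂`) with Néron period pairs `L₁, L₂` for `E ⊗ ℂ`, `E' ⊗ ℂ`: if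
coefficients `c_{ab} ∈ ℂ` (`a ≤ d`, `b ≤ D`), not all zero, satisfy `Σ c_{ab} xᵃ yᵇ = 0` in `ℂ⟦x⟧`,
then `E` and `E'` are isogenous over `ℚ`. This is Bost's "if `h` is algebraic, the algebraic
subgroup `H` of `E × E'` such that `h = Lie H` is `ℚ`-isogenous both to `E` and `E'`" (Cor. 2.5),
via the local parameters `tᵢ = -xᵢ/yᵢ` along the uniformisations `uᵢ` (`gᵢ ∘ uᵢ = tᵢ` for the
coordinate `gᵢ = -x/y` on points) and the tree's `isIsogenous_of_evalEval_comp_eq_zero`.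
[cite: Bost2001AlgebraicLeaves, Cor. 2.5 (proof, p. 173)] -/
theorem isIsogenous_of_sum_C_mul_X_pow_mul_leaf_pow_eq_zero (W₁ W₂ : WeierstrassCurve ℚ)
    [W₁.IsElliptic] {L₁ L₂ : PeriodPair}
    (h₁₂ : L₁.g₂ = (W₁.baseChange ℂ).c₄ / 12) (h₁₃ : L₁.g₃ = (W₁.baseChange ℂ).c₆ / 216)
    (h₂₂ : L₂.g₂ = (W₂.baseChange ℂ).c₄ / 12) (h₂₃ : L₂.g₃ = (W₂.baseChange ℂ).c₆ / 216)
    {d D : ℕ} (c : Fin (d + 1) × Fin (D + 1) → ℂ) (hc : c ≠ 0)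
    (hS : ∑ ab, PowerSeries.C (c ab) * (X ^ (ab.1 : ℕ) *
      (PowerSeries.map (algebraMap ℚ ℂ) (W₂.formalExp.subst W₁.formalLog)) ^ (ab.2 : ℕ)) = 0) :
    IsIsogenous W₁ W₂ := by
  set V₁ := W₁.baseChange ℂ with hV₁
  set V₂ := W₂.baseChange ℂ with hV₂
  -- the relation off a countable set
  obtain ⟨Dset, hDc, hzero⟩ := evalSum_localParam_eq_zero_of_compl W₁ W₂ h₁₂ h₁₃ h₂₂ h₂₃
    Finset.univ c (fun ab => (ab.1 : ℕ)) (fun ab => (ab.2 : ℕ)) hS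
  -- the polynomial `P = Σ c_{ab} Xᵃ Yᵇ ∈ ℂ[X][Y]`
  set P : Polynomial (Polynomial ℂ) :=
    ∑ ab : Fin (d + 1) × Fin (D + 1), Polynomial.monomial (ab.2 : ℕ) (Polynomial.monomial (ab.1 : ℕ) (c ab))
    with hP
  have hPcoeff : ∀ ab : Fin (d + 1) × Fin (D + 1), (P.coeff (ab.2 : ℕ)).coeff (ab.1 : ℕ) = c ab := by
    intro ab
    rw [hP, Polynomial.finsetSum_coeff, Polynomial.finsetSum_coeff]
    simp only [Polynomial.coeff_monomial]
    rw [Finset.sum_eq_single ab]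
    · simp
    · rintro ab' - hne
      by_cases h2 : (ab'.2 : ℕ) = ab.2
      · rw [if_pos h2, Polynomial.coeff_monomial, if_neg]
        intro h1
        exact hne (Prod.ext (Fin.ext h1) (Fin.ext h2))
      · rw [if_neg h2, Polynomial.coeff_zero]
    · intro h; exact absurd (Finset.mem_univ ab) h
  have hP0 : P ≠ 0 := by
    intro h0
    apply hc
    funext ab
    have := hPcoeff ab
    rw [h0, Polynomial.coeff_zero, Polynomial.coeff_zero] at this
    exact this.symm
  have hPeval : ∀ x' y' : ℂ, P.evalEval x' y' = ∑ ab : Fin (d + 1) × Fin (D + 1),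
      c ab * (x' ^ (ab.1 : ℕ) * y' ^ (ab.2 : ℕ)) := by
    intro x' y'
    simp only [hP, Polynomial.evalEval, Polynomial.eval_finsetSum, Polynomial.eval_monomial,
      Polynomial.eval_mul, Polynomial.eval_pow, Polynomial.eval_C]
    refine Finset.sum_congr rfl fun ab _ => by ring
  -- the uniformisations and the coordinate `-x/y`
  obtain ⟨u₁, hker₁, -, hu₁⟩ := L₁.exists_addMonoidHom_of_g₂_g₃' h₁₂ h₁₃
  obtain ⟨u₂, hker₂, -, hu₂⟩ := L₂.exists_addMonoidHom_of_g₂_g₃' h₂₂ h₂₃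
  set g₁ : V₁.toAffine.Point → ℂ := fun Q => match Q with
    | .zero => 0
    | .some x y _ => -x / y with hg₁
  set g₂ : V₂.toAffine.Point → ℂ := fun Q => match Q with
    | .zero => 0
    | .some x y _ => -x / y with hg₂
  have hfib : ∀ (V : WeierstrassCurve ℂ) (g : V.toAffine.Point → ℂ)
      (hg : ∀ Q, g Q = match Q with | .zero => 0 | .some x y _ => -x / y) (w : ℂ),
      {Q | g Q = w}.Finite := by
    intro V g hg w
    refine ((WeierstrassCurve.Affine.Point.finite_setOf_eq_some_negX_div_Y_eq V w).union
      (Set.finite_singleton (0 : V.toAffine.Point))).subset ?_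
    intro Q hQ
    rw [Set.mem_setOf_eq, hg] at hQ
    rcases Q with _ | ⟨x, y, hxy⟩
    · exact Or.inr rfl
    · exact Or.inl ⟨x, y, hxy, rfl, hQ⟩
  have hgu₁ : ∀ z, g₁ (u₁ z) = (if z ∈ L₁.lattice then (0 : ℂ) else
      -(℘[L₁] z - V₁.b₂ / 12) / ((℘'[L₁] z - V₁.a₁ * (℘[L₁] z - V₁.b₂ / 12) - V₁.a₃) / 2)) := by
    intro z
    by_cases hz : z ∈ L₁.lattice
    · have : u₁ z = 0 := by
        rw [← AddMonoidHom.mem_ker, ← SetLike.mem_coe, hker₁]; exact hz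
      rw [if_pos hz, this]
    · obtain ⟨hz', huz⟩ := hu₁ z hz
      rw [if_neg hz, huz]
  have hgu₂ : ∀ z, g₂ (u₂ z) = (if z ∈ L₂.lattice then (0 : ℂ) else
      -(℘[L₂] z - V₂.b₂ / 12) / ((℘'[L₂] z - V₂.a₁ * (℘[L₂] z - V₂.b₂ / 12) - V₂.a₃) / 2)) := by
    intro z
    by_cases hz : z ∈ L₂.lattice
    · have : u₂ z = 0 := by
        rw [← AddMonoidHom.mem_ker, ← SetLike.mem_coe, hker₂]; exact hz
      rw [if_pos hz, this]
    · obtain ⟨hz', huz⟩ := hu₂ z hz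
      rw [if_neg hz, huz]
  refine isIsogenous_of_evalEval_comp_eq_zero h₁₂ h₁₃ h₂₂ h₂₃ u₁ hker₁ u₂ hker₂ g₁
    (hfib V₁ g₁ (fun Q => by rcases Q with _ | ⟨x, y, h⟩ <;> rfl)) g₂
    (hfib V₂ g₂ (fun Q => by rcases Q with _ | ⟨x, y, h⟩ <;> rfl)) hP0 hDc fun z hz => ?_
  rw [hPeval, hgu₁, hgu₂]
  exact hzero z hz

end WeierstrassCurve

end
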